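import Summits.QuantumFields.QCD.Theorems.HeatSlicedQuarksQuarkLoopCoefficientSecondOrderExpansionAuxB

/-!
# Second-order expansion of the heat symbol — part C: free convolution calculus and `E₁`
(line `Sketch` of crux stmt-QuantumFields-16786, stub `stub_secondOrderExpansion`, helper file)

Consequences of the structural identities of the free kernel `k_t = freeKer t` (conjuncts (5), (6) of
`FreeHeatCalculus`: semigroup law and first-order IBP identity), all as `HasSum` statements on `ℤ⁴`
(so that no majorant is needed at this stage):

* the shifted semigroup law `Σ_y k_a(w − y) k_b(y − v) = k_{a+b}(w − v)`;
* the IBP collapses `Σ_y k_a(w−y) (y−v)_ν k_b(y−v) = (b/(a+b)) (w−v)_ν k_{a+b}(w−v)` and its second-order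
  analogue (with the finite-support correction `(ab/(a+b)) Σ_z z_μ z_ν ĥ(z) k_{a+b}(w−v−z)`);
* free convolution `freeConv` of finite combinations of constant spin matrices;
* the collapse of the first-order Duhamel integrand, `freeConv (s−r) (vtx 1 (pert0 r)) w = Σ_v (i/2)k_s(w−v) • η(v)`,
  and the closed form `pert1 s w = −s • Σ_v (i/2) k_s(w−v) • η(v)` (`η(v) = Σ_z (z∧v) ď♯(z)ď(v−z)`).
-/

noncomputable section

namespace Summit.QuantumFields.QCD.Cruxes.QuarkLoopCoefficient.Sketch.SecondOrderExpansion

open Literature.MathematicalPhysics.QuantumLattice Literature.MathematicalPhysics.QuantumFieldTheory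
open Literature.Probability.LatticeModels (Site)
open Summit.QuantumFields.QCD.Theorems.QuarkLoopCoefficient
open Summit.QuantumFields.QCD.Cruxes.QuarkLoopCoefficient.Sketch.HeatSeries
open Summit.QuantumFields.QCD.Cruxes.QuarkLoopCoefficient.Sketch.FreeMajorantToolkit
open scoped Matrix ComplexConjugate

/-! ## §7 The semigroup law and the IBP collapses -/

/-- **Shifted semigroup law**: `Σ_y k_a(w − y) k_b(y − v) = k_{a+b}(w − v)` for `a, b ≥ 0`. -/
theorem hasSum_freeKer_mul_freeKer
    (h5 : ∀ s r : ℝ, 0 ≤ s → 0 ≤ r → ∀ w : Site 4,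
      HasSum (fun y : Site 4 => freeKer s y * freeKer r (w - y)) (freeKer (s + r) w))
    {a b : ℝ} (ha : 0 ≤ a) (hb : 0 ≤ b) (w v : Site 4) :
    HasSum (fun y : Site 4 => freeKer a (w - y) * freeKer b (y - v)) (freeKer (a + b) (w - v)) := by
  have h := h5 b a hb ha (w - v)
  rw [add_comm] at h
  have h' := (Equiv.subRight v).hasSum_iff.mpr h
  refine h'.congr_fun fun y => ?_
  simp only [Function.comp_apply, Equiv.subRight_apply, sub_sub_sub_cancel_right]
  ring

/-- The IBP identity (6) solved for the weighted kernel: `x_ν k_b(x) = −b Σ_z z_ν ĥ(z) k_b(x − z)`. -/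
theorem coord_mul_freeKer_eq
    (h6 : ∀ t : ℝ, 0 ≤ t → ∀ (w : Site 4) (ν : Fin 4),
      t * (∑ z ∈ nbr2 0, ((z ν : ℤ) : ℝ) * hhat z * freeKer t (w - z)) + ((w ν : ℤ) : ℝ) * freeKer t w = 0)
    {b : ℝ} (hb : 0 ≤ b) (x : Site 4) (ν : Fin 4) :
    ((x ν : ℤ) : ℝ) * freeKer b x = ∑ z ∈ nbr2 0, (-(b * (((z ν : ℤ) : ℝ) * hhat z))) * freeKer b (x - z) := by
  have h := h6 b hb x ν
  have : ((x ν : ℤ) : ℝ) * freeKer b x = -(b * ∑ z ∈ nbr2 0, ((z ν : ℤ) : ℝ) * hhat z * freeKer b (x - z)) := by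
    linarith
  rw [this, Finset.mul_sum, ← Finset.sum_neg_distrib]
  refine Finset.sum_congr rfl fun z _ => ?_
  ring

/-- **First-order IBP collapse**:
`Σ_y k_a(w−y) (y−v)_ν k_b(y−v) = (b/(a+b)) (w−v)_ν k_{a+b}(w−v)` for `a, b ≥ 0`, `a + b > 0`. -/
theorem hasSum_freeKer_mul_coord_mul_freeKer
    (h5 : ∀ s r : ℝ, 0 ≤ s → 0 ≤ r → ∀ w : Site 4,
      HasSum (fun y : Site 4 => freeKer s y * freeKer r (w - y)) (freeKer (s + r) w))
    (h6 : ∀ t : ℝ, 0 ≤ t → ∀ (w : Site 4) (ν : Fin 4),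
      t * (∑ z ∈ nbr2 0, ((z ν : ℤ) : ℝ) * hhat z * freeKer t (w - z)) + ((w ν : ℤ) : ℝ) * freeKer t w = 0)
    {a b : ℝ} (ha : 0 ≤ a) (hb : 0 ≤ b) (hab : 0 < a + b) (w v : Site 4) (ν : Fin 4) :
    HasSum (fun y : Site 4 => freeKer a (w - y) * ((((y - v) ν : ℤ) : ℝ) * freeKer b (y - v)))
      (b / (a + b) * ((((w - v) ν : ℤ) : ℝ) * freeKer (a + b) (w - v))) := by
  -- rewrite the weighted kernel with the IBP identity, pointwise in `y`
  have hfun : ∀ y : Site 4, freeKer a (w - y) * ((((y - v) ν : ℤ) : ℝ) * freeKer b (y - v)) =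
      ∑ z ∈ nbr2 0, (-(b * (((z ν : ℤ) : ℝ) * hhat z))) * (freeKer a (w - y) * freeKer b (y - (v + z))) := by
    intro y
    rw [coord_mul_freeKer_eq h6 hb (y - v) ν, Finset.mul_sum]
    refine Finset.sum_congr rfl fun z _ => ?_
    rw [sub_sub]; ring
  -- the value, from the IBP identity at time `a + b`
  have hval : b / (a + b) * ((((w - v) ν : ℤ) : ℝ) * freeKer (a + b) (w - v)) =
      ∑ z ∈ nbr2 0, (-(b * (((z ν : ℤ) : ℝ) * hhat z))) * freeKer (a + b) (w - (v + z)) := by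
    have h := h6 (a + b) hab.le (w - v) ν
    have e : (((w - v) ν : ℤ) : ℝ) * freeKer (a + b) (w - v) =
        -((a + b) * ∑ z ∈ nbr2 0, ((z ν : ℤ) : ℝ) * hhat z * freeKer (a + b) (w - v - z)) := by linarith
    have e2 : ∀ S : ℝ, b / (a + b) * -((a + b) * S) = (-b) * S := fun S => by field_simp
    rw [e, e2, Finset.mul_sum]
    refine Finset.sum_congr rfl fun z _ => ?_
    rw [sub_sub]
    ring
  rw [hval]
  refine (hasSum_sum fun z _ => (hasSum_freeKer_mul_freeKer h5 ha hb w (v + z)).mul_left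
    (-(b * (((z ν : ℤ) : ℝ) * hhat z)))).congr_fun fun y => ?_
  exact hfun y

/-- **Second-order IBP collapse**: for `a, b ≥ 0`, `a + b > 0`,
`Σ_y k_a(w−y) (y−v)_μ (y−v)_ν k_b(y−v) = (b/(a+b))² (w−v)_μ (w−v)_ν k_{a+b}(w−v)
  − (ab/(a+b)) Σ_{z ∈ nbr2 0} z_μ z_ν ĥ(z) k_{a+b}(w − v − z)`. -/
theorem hasSum_freeKer_mul_coord_mul_coord_mul_freeKer
    (h5 : ∀ s r : ℝ, 0 ≤ s → 0 ≤ r → ∀ w : Site 4,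
      HasSum (fun y : Site 4 => freeKer s y * freeKer r (w - y)) (freeKer (s + r) w))
    (h6 : ∀ t : ℝ, 0 ≤ t → ∀ (w : Site 4) (ν : Fin 4),
      t * (∑ z ∈ nbr2 0, ((z ν : ℤ) : ℝ) * hhat z * freeKer t (w - z)) + ((w ν : ℤ) : ℝ) * freeKer t w = 0)
    {a b : ℝ} (ha : 0 ≤ a) (hb : 0 ≤ b) (hab : 0 < a + b) (w v : Site 4) (μ ν : Fin 4) :
    HasSum (fun y : Site 4 =>
        freeKer a (w - y) * ((((y - v) μ : ℤ) : ℝ) * (((y - v) ν : ℤ) : ℝ) * freeKer b (y - v)))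
      ((b / (a + b)) ^ 2 * ((((w - v) μ : ℤ) : ℝ) * (((w - v) ν : ℤ) : ℝ) * freeKer (a + b) (w - v)) -
        a * b / (a + b) * ∑ z ∈ nbr2 0,
          ((z μ : ℤ) : ℝ) * ((z ν : ℤ) : ℝ) * hhat z * freeKer (a + b) (w - v - z)) := by
  -- pointwise: `y_μ y_ν k_b(y) = Σ_z (−b z_ν ĥ z) [ (y−z)_μ k_b(y−z) + z_μ k_b(y−z) ]` (with `y ← y − v`)
  have hfun : ∀ y : Site 4,
      freeKer a (w - y) * ((((y - v) μ : ℤ) : ℝ) * (((y - v) ν : ℤ) : ℝ) * freeKer b (y - v)) =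
      ∑ z ∈ nbr2 0, (-(b * (((z ν : ℤ) : ℝ) * hhat z))) *
        (freeKer a (w - y) * ((((y - (v + z)) μ : ℤ) : ℝ) * freeKer b (y - (v + z))) +
          ((z μ : ℤ) : ℝ) * (freeKer a (w - y) * freeKer b (y - (v + z)))) := by
    intro y
    have e : (((y - v) μ : ℤ) : ℝ) * (((y - v) ν : ℤ) : ℝ) * freeKer b (y - v) =
        (((y - v) μ : ℤ) : ℝ) * ((((y - v) ν : ℤ) : ℝ) * freeKer b (y - v)) := by ring
    rw [e, coord_mul_freeKer_eq h6 hb (y - v) ν, Finset.mul_sum, Finset.mul_sum]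
    refine Finset.sum_congr rfl fun z _ => ?_
    have ec : (((y - v) μ : ℤ) : ℝ) = (((y - (v + z)) μ : ℤ) : ℝ) + ((z μ : ℤ) : ℝ) := by
      simp only [Pi.sub_apply, Pi.add_apply]; push_cast; ring
    rw [sub_sub, ec]; ring
  -- the values of the two pieces
  have h1 : ∀ z : Site 4, HasSum (fun y : Site 4 =>
      freeKer a (w - y) * ((((y - (v + z)) μ : ℤ) : ℝ) * freeKer b (y - (v + z))))
      (b / (a + b) * ((((w - (v + z)) μ : ℤ) : ℝ) * freeKer (a + b) (w - (v + z)))) := fun z =>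
    hasSum_freeKer_mul_coord_mul_freeKer h5 h6 ha hb hab w (v + z) μ
  have h2 : ∀ z : Site 4, HasSum (fun y : Site 4 =>
      ((z μ : ℤ) : ℝ) * (freeKer a (w - y) * freeKer b (y - (v + z))))
      (((z μ : ℤ) : ℝ) * freeKer (a + b) (w - (v + z))) := fun z =>
    (hasSum_freeKer_mul_freeKer h5 ha hb w (v + z)).mul_left _
  have hsum := hasSum_sum fun z (_ : z ∈ nbr2 0) =>
    ((h1 z).add (h2 z)).mul_left (-(b * (((z ν : ℤ) : ℝ) * hhat z)))
  -- identify the value: expand `(w − v − z)_μ = (w − v)_μ − z_μ` and use IBP at time `a + b`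
  have hab' : (a + b) ≠ 0 := hab.ne'
  have key := h6 (a + b) hab.le (w - v) ν
  -- `S := Σ_z z_ν ĥ(z) k_{a+b}(w−v−z) = −(w−v)_ν k_{a+b}(w−v)/(a+b)`
  have hS : ∑ z ∈ nbr2 0, ((z ν : ℤ) : ℝ) * hhat z * freeKer (a + b) (w - v - z) =
      -((((w - v) ν : ℤ) : ℝ) * freeKer (a + b) (w - v)) / (a + b) := by
    field_simp
    linarith
  have hexp : ∑ z ∈ nbr2 0, (-(b * (((z ν : ℤ) : ℝ) * hhat z))) *
      (b / (a + b) * ((((w - (v + z)) μ : ℤ) : ℝ) * freeKer (a + b) (w - (v + z))) +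
        ((z μ : ℤ) : ℝ) * freeKer (a + b) (w - (v + z))) =
      (-(b * b / (a + b)) * (((w - v) μ : ℤ) : ℝ)) *
          ∑ z ∈ nbr2 0, ((z ν : ℤ) : ℝ) * hhat z * freeKer (a + b) (w - v - z) +
        (b * b / (a + b) - b) *
          ∑ z ∈ nbr2 0, ((z μ : ℤ) : ℝ) * ((z ν : ℤ) : ℝ) * hhat z * freeKer (a + b) (w - v - z) := by
    rw [Finset.mul_sum, Finset.mul_sum, ← Finset.sum_add_distrib]
    refine Finset.sum_congr rfl fun z _ => ?_
    have ec : (((w - (v + z)) μ : ℤ) : ℝ) = (((w - v) μ : ℤ) : ℝ) - ((z μ : ℤ) : ℝ) := by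
      simp only [Pi.sub_apply, Pi.add_apply]; push_cast; ring
    rw [ec, ← sub_sub]
    field_simp
    ring
  have hv : ∑ z ∈ nbr2 0, (-(b * (((z ν : ℤ) : ℝ) * hhat z))) *
      (b / (a + b) * ((((w - (v + z)) μ : ℤ) : ℝ) * freeKer (a + b) (w - (v + z))) +
        ((z μ : ℤ) : ℝ) * freeKer (a + b) (w - (v + z))) =
      (b / (a + b)) ^ 2 * ((((w - v) μ : ℤ) : ℝ) * (((w - v) ν : ℤ) : ℝ) * freeKer (a + b) (w - v)) -
        a * b / (a + b) * ∑ z ∈ nbr2 0,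
          ((z μ : ℤ) : ℝ) * ((z ν : ℤ) : ℝ) * hhat z * freeKer (a + b) (w - v - z) := by
    rw [hexp, hS]
    field_simp
    ring
  rw [hv] at hsum
  exact hsum.congr_fun fun y => hfun y

/-! ## §8 Free convolution of finite combinations -/

/-- `freeConv` of a finite combination `Σ_{i ∈ S} c_i(y) • M_i` of constant matrices with summable
scalar coefficient functions: `freeConv t g w = Σ_i (Σ_y k_t(w−y) c_i(y)) • M_i`. -/
theorem freeConv_finset_sum_smul {ι : Type*} (S : Finset ι) (c : ι → Site 4 → ℂ) (M : ι → Spin)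
    (t : ℝ) (w : Site 4)
    (hc : ∀ i ∈ S, Summable (fun y : Site 4 => ((freeKer t (w - y) : ℝ) : ℂ) * c i y)) :
    freeConv t (fun y => ∑ i ∈ S, c i y • M i) w =
      ∑ i ∈ S, (∑' y : Site 4, ((freeKer t (w - y) : ℝ) : ℂ) * c i y) • M i := by
  unfold freeConv
  have hterm : ∀ y : Site 4, ((freeKer t (w - y) : ℝ) : ℂ) • ∑ i ∈ S, c i y • M i =
      ∑ i ∈ S, (((freeKer t (w - y) : ℝ) : ℂ) * c i y) • M i := by
    intro y
    rw [Finset.smul_sum]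
    refine Finset.sum_congr rfl fun i _ => ?_
    rw [smul_smul]
  simp_rw [hterm]
  rw [Summable.tsum_finsetSum (fun i hi => (hc i hi).smul_const (M i))]
  refine Finset.sum_congr rfl fun i hi => ?_
  exact (hc i hi).tsum_smul_const (M i)

/-- Real `HasSum` statements give complex summability of the cast coefficient functions. -/
theorem summable_ofReal_mul_of_hasSum {f : Site 4 → ℝ} {a : ℝ} (t : ℝ) (w : Site 4)
    (h : HasSum (fun y : Site 4 => freeKer t (w - y) * f y) a) :
    Summable (fun y : Site 4 => ((freeKer t (w - y) : ℝ) : ℂ) * ((f y : ℝ) : ℂ)) := by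
  have := (Complex.hasSum_ofReal.mpr h).summable
  refine this.congr fun y => ?_
  push_cast; ring

/-- ... and the value of the complex series. -/
theorem tsum_ofReal_mul_of_hasSum {f : Site 4 → ℝ} {a : ℝ} (t : ℝ) (w : Site 4)
    (h : HasSum (fun y : Site 4 => freeKer t (w - y) * f y) a) :
    ∑' y : Site 4, ((freeKer t (w - y) : ℝ) : ℂ) * ((f y : ℝ) : ℂ) = ((a : ℝ) : ℂ) := by
  have h' : HasSum (fun y : Site 4 => ((freeKer t (w - y) : ℝ) : ℂ) * ((f y : ℝ) : ℂ)) ((a : ℝ) : ℂ) := by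
    have := Complex.hasSum_ofReal.mpr h
    refine this.congr_fun fun y => ?_
    push_cast; ring
  exact h'.tsum_eq

/-! ## §9 The first-order term `E₁ = pert1` -/

/-- **Collapse of the first-order Duhamel integrand**: for `0 ≤ r ≤ s`,
`freeConv (s − r) (vtx 1 (pert0 r)) w = Σ_v ((i/2) k_s(w − v)) • η(v)`. -/
theorem freeConv_vtx_one_pert0
    (h1 : ∀ x y : Site 4, sqKer (fun _ => (1 : ℂ)) x y = ((hhat (y - x) : ℝ) : ℂ) • (1 : Spin))
    (h3 : ∀ w : Site 4, freeKer 0 w = if w = 0 then 1 else 0)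
    (h5 : ∀ s r : ℝ, 0 ≤ s → 0 ≤ r → ∀ w : Site 4,
      HasSum (fun y : Site 4 => freeKer s y * freeKer r (w - y)) (freeKer (s + r) w))
    (h6 : ∀ t : ℝ, 0 ≤ t → ∀ (w : Site 4) (ν : Fin 4),
      t * (∑ z ∈ nbr2 0, ((z ν : ℤ) : ℝ) * hhat z * freeKer t (w - z)) + ((w ν : ℤ) : ℝ) * freeKer t w = 0)
    {s r : ℝ} (hr : 0 ≤ r) (hrs : r ≤ s) (w : Site 4) :
    freeConv (s - r) (vtx 1 (pert0 r)) w = ∑ v ∈ nbr2 0, (Complex.I / 2 * ((freeKer s (w - v) : ℝ) : ℂ)) •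
      ∑ z ∈ nbr 0, ((wedge z v : ℤ) : ℂ) • (dsharp z * dsymb (v - z)) := by
  have hsr : 0 ≤ s - r := sub_nonneg.mpr hrs
  have hvtx : vtx 1 (pert0 r) = fun y => ∑ v ∈ nbr2 0, (Complex.I / 2 * ((freeKer r (y - v) : ℝ) : ℂ)) •
      ∑ z ∈ nbr 0, ((wedge z v : ℤ) : ℂ) • (dsharp z * dsymb (v - z)) := by
    funext y; exact vtx_one_pert0 h1 h3 h6 hr y
  rw [hvtx]
  have hS : ∀ v : Site 4, HasSum (fun y : Site 4 => freeKer (s - r) (w - y) * freeKer r (y - v))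
      (freeKer s (w - v)) := by
    intro v
    have := hasSum_freeKer_mul_freeKer h5 hsr hr w v
    rwa [sub_add_cancel] at this
  rw [freeConv_finset_sum_smul (nbr2 0)
    (fun v y => Complex.I / 2 * ((freeKer r (y - v) : ℝ) : ℂ)) _ (s - r) w ?_]
  · refine Finset.sum_congr rfl fun v _ => ?_
    congr 1
    have e : ∀ y : Site 4, ((freeKer (s - r) (w - y) : ℝ) : ℂ) * (Complex.I / 2 * ((freeKer r (y - v) : ℝ) : ℂ)) =
        Complex.I / 2 * (((freeKer (s - r) (w - y) : ℝ) : ℂ) * ((freeKer r (y - v) : ℝ) : ℂ)) := by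
      intro y; ring
    simp_rw [e]
    rw [tsum_mul_left, tsum_ofReal_mul_of_hasSum (s - r) w (hS v)]
  · intro v _
    have := (summable_ofReal_mul_of_hasSum (s - r) w (hS v)).mul_left (Complex.I / 2)
    refine this.congr fun y => ?_
    ring

/-- **Closed form of the first-order term**: for `s ≥ 0`,
`pert1 s w = −s • Σ_{v ∈ nbr2 0} ((i/2) k_s(w − v)) • η(v)`, i.e. `E₁(s) = −s (η₁ ∗ k_s)` with
`η₁ = (i/2) η`. -/
theorem pert1_eq
    (h1 : ∀ x y : Site 4, sqKer (fun _ => (1 : ℂ)) x y = ((hhat (y - x) : ℝ) : ℂ) • (1 : Spin))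
    (h3 : ∀ w : Site 4, freeKer 0 w = if w = 0 then 1 else 0)
    (h5 : ∀ s r : ℝ, 0 ≤ s → 0 ≤ r → ∀ w : Site 4,
      HasSum (fun y : Site 4 => freeKer s y * freeKer r (w - y)) (freeKer (s + r) w))
    (h6 : ∀ t : ℝ, 0 ≤ t → ∀ (w : Site 4) (ν : Fin 4),
      t * (∑ z ∈ nbr2 0, ((z ν : ℤ) : ℝ) * hhat z * freeKer t (w - z)) + ((w ν : ℤ) : ℝ) * freeKer t w = 0)
    {s : ℝ} (hs : 0 ≤ s) (w : Site 4) :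
    pert1 s w = -((s : ℂ) • ∑ v ∈ nbr2 0, (Complex.I / 2 * ((freeKer s (w - v) : ℝ) : ℂ)) •
      ∑ z ∈ nbr 0, ((wedge z v : ℤ) : ℂ) • (dsharp z * dsymb (v - z))) := by
  ext α β
  simp only [pert1, Matrix.of_apply, Matrix.neg_apply, Matrix.smul_apply, smul_eq_mul]
  congr 1
  rw [intervalIntegral.integral_congr (g := fun _ => (∑ v ∈ nbr2 0,
      (Complex.I / 2 * ((freeKer s (w - v) : ℝ) : ℂ)) •
        ∑ z ∈ nbr 0, ((wedge z v : ℤ) : ℂ) • (dsharp z * dsymb (v - z))) α β)]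
  · rw [intervalIntegral.integral_const, sub_zero, Complex.real_smul]
  · intro r hr
    rw [Set.uIcc_of_le hs] at hr
    simp only
    rw [freeConv_vtx_one_pert0 h1 h3 h5 h6 hr.1 hr.2 w]

/-! ## Registered headline -/

/-- Registered headline of this helper file (aux stub `stub_secondOrderExpansionAuxC` of crux
stmt-QuantumFields-16786, line `Sketch`): the shifted semigroup law of the free kernel. -/
theorem stub_secondOrderExpansionAuxC : (∀ s r : ℝ, 0 ≤ s → 0 ≤ r → ∀ w : Site 4, HasSum (fun y : Site 4 => freeKer s y * freeKer r (w - y)) (freeKer (s + r) w)) → ∀ (a b : ℝ), 0 ≤ a → 0 ≤ b → ∀ (w v : Site 4), HasSum (fun y : Site 4 => freeKer a (w - y) * freeKer b (y - v)) (freeKer (a + b) (w - v)) :=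
  fun h5 _ _ ha hb w v => hasSum_freeKer_mul_freeKer h5 ha hb w v

end Summit.QuantumFields.QCD.Cruxes.QuarkLoopCoefficient.Sketch.SecondOrderExpansion

end
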